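import Summits.Ventures.YMGap.YM3IR.BalabanSUN
import Summits.Ventures.YMGap.RobustBall.TorusRowsSU3YM3
import HarnessLib

/-!
# YM3IR / BalabanSU3 — the YM₃ promise sentence for `SU(3)`: print ∧ the cell's two `SU(3)` one-link hypotheses ∧ ONE
conjecture (UV side's instantiation × engine-2's conditional `d = 3` rows; theorems only)

HONEST FRAMING (cell pub-ymgap, track Y4 / YM3-IR, seat ym3ir-theory-1, gen 4).  This file claims NO summit, NO mass gap
and NO part of Bałaban's theorems.  It is kernel-checked BOOKKEEPING: the `SU(N)` composition of `YM3IR/BalabanSUN.lean`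
(`massGap3Cofinal_suN_balaban_of_irConjecture3`) at `N = 3` with track Y2's input supplied by engine-2's `d = 3` row
`RobustBallSU3.su3_ym3Row_1_4` (`RobustBall/TorusRowsSU3YM3.lean`) — the receiving conjecture `ClusterDomainClustering`
for the ball spec ⟨fundamental `SU(3)`, Wilson ceiling `β⋆ = (1/4)/3` (= `β_W = 1/4` in tree units `β = β_W/N`), membership
in `RobustBall.ClusterDomainFR (2·0.23) 0.23 r`⟩ at rate `−log ρ⋆/(r ⊔ 1)`, `ρ⋆ = e^{0.46}(28/15)(1/4) + e^{0.23}√(4/5)·0.23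
< 1`, ONE constant `A = 24` — which is itself CONDITIONAL on the cell's two `SU(3)` one-link hypotheses
H1 = `OneLinkPoincareSUN 3 (3/5) (4/5)` and H2 = `OneLinkVarianceBound 3 (11/30) (49/20)` (declared inputs of the `SU(3)`
column, NOT certified in the tree at the time of writing).  So, unlike the `SU(2)` file (`BalabanSU2.lean`, ONE non-printed
hypothesis), the `SU(3)` end theorem carries THREE hypotheses that are neither printed theorems' `Prop`s nor certified rows:
H1, H2 and `IRConjecture3`.  No axiom, no `sorry`, no `def`.

THE HYPOTHESIS LIST, VERBATIM (`massGap3Cofinal_su3_balaban_of_pair_of_irConjecture3`):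
* `BalabanUV3 mk` — IN PRINT (T. Bałaban, CMP 102 (1985), Thm 1 p. 257 + Thm 2 p. 272; the tree's `Prop`s);
* `Nonempty (Family L eps0)` — print's clauses at ONE coupling (p. 256 L15–18), or Theorem 2's own `ε₀` (`printedOrder` form);
* `0 < C_b`, `0 < κ` — positivity of the conjecture's two bookkeeping constants;
* H1 `OneLinkPoincareSUN 3 (3/5) (4/5)`, H2 `OneLinkVarianceBound 3 (11/30) (49/20)` — the cell's `SU(3)` one-link
  Poincaré / variance hypotheses (track Y2, engine-2's column; OPEN in the tree);
* `IRConjecture3 (ballOfRobustBallFR 3 (2·(23/100)) (23/100) r ((1/4)/3)) suFrobDist (fundamentalRep (Fin 3))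
  (balabanCouplings L (suGroupModel 3) eps0) C_b κ` — the ONE CONJECTURE of track Y4 (NOT in print; theory-2, `Statement.lean`).
CONCLUSION: `MassGap3Cofinal (balabanCouplings L (suGroupModel 3) eps0) suFrobDist (fundamentalRep (Fin 3))` — volume-uniform
exponential clustering of the fine `SU(3)` Wilson laws in `d = 3` at rate `m₀/β` on the block family's tori, at every
coupling of Bałaban's unbounded `SU(3)` coupling set.  A LATTICE statement; no continuum limit, no Millennium claim.

References: T. Bałaban, CMP 102 (1985) 255–275, p. 256 L15–18, (5) p. 256, Thm 1 p. 257, Thm 2 p. 272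
[cite: Balaban1985UV3]; K. Osterwalder, E. Seiler, Ann. Phys. 110 (1978) 440, §3 [cite: OsterwalderSeilerAnnPhys1978];
H. Föllmer, LNM 1362 (1988) Ch. I (2.14)/(2.24) [cite: Follmer1988].
-/

noncomputable section

open MeasureTheory
open Literature.MathematicalPhysics.QuantumLattice Literature.MathematicalPhysics.QuantumFieldTheory
open Balaban1985CMP102 Balaban1985CMP102.Setting Balaban1985CMP102.Theorems
open Literature.MathematicalPhysics.QuantumFieldTheory.Balaban1983to89 (GaugeGroup HaarData)
open Summit.QuantumFields.Balaban3D.Carriers (suGroupModel)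
open Summit.QuantumFields.BalabanUV.InfraRed.StrongCouplingPoincareDoorSUN (OneLinkPoincareSUN)
open Summit.QuantumFields.BalabanUV.InfraRed.StrongCouplingVarianceDoorSUN (OneLinkVarianceBound)

namespace Summit.Ventures.YMGap.YM3IR

open CarrierBridge

/-- Engine-2's `SU(3)` `d = 3` row value at `(β_W, ε) = (1/4, 23/100)` is in `(0, 1)`: `ρ⋆ = e^{0.46}·(28/15)·(1/4) +
e^{0.23}·√(4/5)·0.23 < 1` (PROVED arithmetic via `RobustBallSU3.torus_rowValue_le_taylor` and a rational certificate). [folklore] -/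
theorem su3_dim3_quarter_rowValue_lt_one :
    Real.exp (2 * (23 / 100)) * (28 / 15 * (1 / 4)) + Real.exp (23 / 100) * Real.sqrt (4 / 5) * (23 / 100) < (1 : ℝ) := by
  have ht := RobustBallSU3.torus_rowValue_le_taylor (d := 3) (by norm_num) (βW := 1 / 4) (ε := 23 / 100) (by norm_num)
    (by norm_num) (by norm_num)
  have e : (14 : ℝ) / 15 * ((((3 : ℕ) : ℝ) - 1) * (1 / 4)) = 28 / 15 * (1 / 4) := by push_cast; ring
  rw [e] at ht
  exact lt_of_le_of_lt ht (by norm_num)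

/-- The rate of engine-2's `SU(3)` `d = 3` row `(β_W, ε) = (1/4, 23/100)` is positive, in the row's own elaborated form
`−log ρ⋆ / ↑(max r 1)`. [folklore] -/
theorem su3_dim3_quarter_rate_pos' (r : ℕ) :
    0 < -Real.log (Real.exp (2 * (23 / 100)) * (28 / 15 * (1 / 4)) + Real.exp (23 / 100) * Real.sqrt (4 / 5) * (23 / 100)) /
      ((max r 1 : ℕ) : ℝ) :=
  div_pos (neg_pos.2 (Real.log_neg (by positivity) su3_dim3_quarter_rowValue_lt_one))
    (Nat.cast_pos.2 (lt_of_lt_of_le Nat.one_pos (le_max_right r 1)))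

/-- **`SU(3)` lattice YM₃ mass gap on Bałaban's coupling set: print ∧ H1 ∧ H2 ∧ ONE conjecture (PROVED bookkeeping).**
`Nonempty (Family L eps0) → 0 < C_b → 0 < κ → BalabanUV3 mk → OneLinkPoincareSUN 3 (3/5) (4/5) → OneLinkVarianceBound 3
(11/30) (49/20) → IRConjecture3 (ballOfRobustBallFR 3 (2·(23/100)) (23/100) r ((1/4)/3)) suFrobDist ρ_fund (balabanCouplings L
(suGroupModel 3) eps0) C_b κ → MassGap3Cofinal (balabanCouplings L (suGroupModel 3) eps0) suFrobDist ρ_fund` — the receiving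
conjecture `ClusterDomainClustering` is engine-2's row `RobustBallSU3.su3_ym3Row_1_4 hP hV r` (β_W = 1/4, ε = 23/100, `A = 24`,
any finite range `r`), consumed BY NAME; H1/H2 are that row's declared one-link inputs.
[cite: Balaban1985UV3, Thm 1 p.257; Thm 2 p.272] -/
theorem massGap3Cofinal_su3_balaban_of_pair_of_irConjecture3 {L : ℕ} {mk : Construction L} {eps0 : ℝ → ℝ}
    (hfam : Nonempty (Family L eps0)) (r : ℕ) {C_b κ : ℝ} (hC : 0 < C_b) (hκ : 0 < κ) (hUV : BalabanUV3 mk)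
    (hP : OneLinkPoincareSUN 3 (3 / 5) (4 / 5)) (hV : OneLinkVarianceBound 3 (11 / 30) (49 / 20))
    (hIR : IRConjecture3 (ballOfRobustBallFR 3 (2 * (23 / 100)) (23 / 100) r ((1 / 4) / 3)) suFrobDist
      (fundamentalRep (Fin 3)) (balabanCouplings L (suGroupModel 3) eps0) C_b κ) :
    MassGap3Cofinal (balabanCouplings L (suGroupModel 3) eps0) suFrobDist
      (fundamentalRep (Fin 3) : RobustBall.SUN 3 →* Matrix (Fin 3) (Fin 3) ℂ) :=
  massGap3Cofinal_suN_balaban_of_irConjecture3 hfam hC hκ (su3_dim3_quarter_rate_pos' r) hUV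
    (RobustBallSU3.su3_ym3Row_1_4 hP hV r) hIR

/-- **In PRINT'S quantifier order (PROVED bookkeeping):** from `BalabanUV3 mk`, at THEOREM 2's own terminal spacing `ε₀`
for `SU(3)`: for every finite range `r` and positive `C_b, κ`, `Nonempty (Family L eps0) → H1 → H2 → IRConjecture3 (…) … →
MassGap3Cofinal …`. [cite: Balaban1985UV3, p.256 L15–18; Thm 2 p.272] -/
theorem massGap3Cofinal_su3_balaban_printedOrder_of_pair_of_irConjecture3 {L : ℕ} (mk : Construction L)
    (hUV : BalabanUV3 mk) :
    ∃ eps0 : ℝ → ℝ, (∀ g : ℝ, 0 < g → 0 < eps0 g) ∧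
      (∀ S : Family L eps0, ∀ k, k ≤ S.1.K → (mk (RobustBall.SUN 3) (suGroupModel 3) S.1).ineq41_47 k) ∧
      ∀ (r : ℕ) (C_b κ : ℝ), 0 < C_b → 0 < κ → Nonempty (Family L eps0) →
        OneLinkPoincareSUN 3 (3 / 5) (4 / 5) → OneLinkVarianceBound 3 (11 / 30) (49 / 20) →
        IRConjecture3 (ballOfRobustBallFR 3 (2 * (23 / 100)) (23 / 100) r ((1 / 4) / 3)) suFrobDist
          (fundamentalRep (Fin 3)) (balabanCouplings L (suGroupModel 3) eps0) C_b κ →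
          MassGap3Cofinal (balabanCouplings L (suGroupModel 3) eps0) suFrobDist
            (fundamentalRep (Fin 3) : RobustBall.SUN 3 →* Matrix (Fin 3) (Fin 3) ℂ) := by
  obtain ⟨eps0, hpos, h2, h⟩ := massGap3Cofinal_suN_balaban_printedOrder_of_irConjecture3 (N := 3) mk hUV
  exact ⟨eps0, hpos, h2, fun r C_b κ hC hκ hfam hP hV hIR =>
    h (ballOfRobustBallFR 3 (2 * (23 / 100)) (23 / 100) r ((1 / 4) / 3)) C_b κ _ hC hκ (su3_dim3_quarter_rate_pos' r)
      hfam (RobustBallSU3.su3_ym3Row_1_4 hP hV r) hIR⟩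

/-- **`SU(3)` at engine-2's tier-1 ceiling `β⋆ = (1/4)/3` (`β_W = 1/4`; PROVED arithmetic):** a member's coupling after
`K + M'` steps is below `(1/4)/3` iff `L^{M'} ≥ 4/γ₀²`. [cite: Balaban1985UV3, (5) p.256] -/
theorem su3_betaTree_div_pow_le_twelfth_iff {L : ℕ} (S : Scales L) (M' : ℕ) :
    betaTree (suGroupModel 3) S / (L : ℝ) ^ (S.K + M') ≤ (1 / 4) / 3 ↔ 4 / Dictionary.gammaSq S ≤ (L : ℝ) ^ M' := by
  rw [suN_betaTree_div_pow_le_iff S M' (by norm_num : (0 : ℝ) < (1 / 4) / 3)]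
  have hγ : 0 < Dictionary.gammaSq S := Dictionary.gammaSq_pos S
  have e : (((3 : ℕ) : ℝ) * Dictionary.gammaSq S * ((1 / 4) / 3))⁻¹ = 4 / Dictionary.gammaSq S := by
    push_cast
    field_simp
  rw [e]

/-- **The conjecture's counted task on this row (PROVED arithmetic):** a member of Bałaban's `SU(3)` family whose
canonical-scaling coupling after `K + M'` steps lies in this row's Wilson window (`≤ (1/4)/3`) has `L^{M'} ≥ 4/γ₀² ≥ 4` —
`IRConjecture3` on this ball must control at least `⌈log_L 4⌉` blockings at `O(1)` coupling beyond Bałaban's `K`, uniformly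
in the spacing and the volume. [cite: Balaban1985UV3, (5) p.256] -/
theorem su3_row_quarter_crossover_steps {L : ℕ} (S : Scales L) (M' : ℕ)
    (h : betaTree (suGroupModel 3) S / (L : ℝ) ^ (S.K + M') ≤
      (ballOfRobustBallFR 3 (2 * (23 / 100)) (23 / 100) 0 ((1 / 4) / 3)).βstar) :
    (4 : ℝ) ≤ (L : ℝ) ^ M' := by
  have hγ : 0 < Dictionary.gammaSq S := Dictionary.gammaSq_pos S
  have hγ1 : Dictionary.gammaSq S ≤ 1 := Dictionary.gammaSq_le_one S
  have h4 : 4 / Dictionary.gammaSq S ≤ (L : ℝ) ^ M' := (su3_betaTree_div_pow_le_twelfth_iff S M').1 h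
  have h44 : (4 : ℝ) ≤ 4 / Dictionary.gammaSq S := by
    rw [le_div_iff₀ hγ]
    nlinarith
  exact h44.trans h4

end Summit.Ventures.YMGap.YM3IR

end
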